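import Mathlib
import Summits.CriticalPhenomena.Ising3DConformalLimit.Theorems.GaussianScaleMixtureCriticalTwoPointGSMJsApproximants
import Literature.Probability.LatticeModels.CriticalTwoPointLower

/-!
# Crux `CriticalTwoPointGSM`, line `Sketch` (canonical-lift spine, seat c1) — stub `diag_approximants`

The finite-`N` **diagonal** joint spectral measures of the critical two-point function
`G = ⟨σ₀σ_·⟩⁺_{β_c}` of the nearest-neighbour Ising model on `ℤ³`, relative to the swap-mirror
plane `{x | x 0 = x 1}`: plane sites are written `ι w = w 0 • (e₀ + e₁) + w 1 • e₂` (`w ∈ ℤ²`),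
the normal step is `u = e₀ - e₁`, and the diagonal data are `G_d(n, w) = G(ι w + n • u)`
(the two-point function at `(w₀ + n, w₀ - n, w₁)`).

For `N ≥ 1` let `box = [0,N)² ⊆ ℤ²`, `grid = (-N,N]² ⊆ ℤ²`, and for `j ∈ grid` let
`μ_{c,j}`, `μ_{s,j}` be the Hausdorff measures on `[0,1]` of the real coefficient vectors
`w ↦ cos(π j·w/N)`, `w ↦ sin(π j·w/N)` on `ι(box)`, given by the diagonal Hausdorff
representation (hypothesis `hD`, the statement of `Theorems.diagSpectralRepresentation`:
`∑_{x,y ∈ s} v_x v_y G(y - x + N' u) = ∫ t^{N'} dμ_v` for finite `s` in the plane). Transported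
to `ℤ²` along `ι` (`CriticalTwoPointGSMJs.DiagApproximants.exists_hausdorff`), with the swap
symmetry `G(ι w - n u) = G(ι w + n u)` (`twoPointPlus_perm_invariant_holds`) turning `t^{N'}`
into `t^{|n|}`, `n ∈ ℤ`, this is the exact analogue of the axial representation used in
`Theorems.js_approximants`, and the construction of that file goes through verbatim: pushing
`μ_{c,j} + μ_{s,j}` to the momentum `k_j = πj/N` by `t ↦ (t, k_j)` and summing over `j ∈ grid`
with the weight `(N²(2N)²)⁻¹` gives a measure `ρ_N` on `ℝ³` carried by `[0,1]×[-π,π]²` whose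
joint moments `∫ λ^{|n|} cos(k·z) dρ_N` are, by the collapsed identity of `diag_cesaroIdentity`
(hypothesis `hces`), the Cesàro-weighted values `#{(x,y) ∈ box² : x-y = z}·G_d(n,z)/N²`; at
`n = 0`, `z = 0` this is `G(0) = 1`, so `ρ_N` is a probability measure. This is the theorem
`diag_approximants` below; the generic helper lemmas (push-forwards `t ↦ (t, k)` of axis
measures, the diagonal pair count, the normalisation) are those of
`CriticalTwoPointGSMJs.JsApproximants`.
-/

noncomputable section

namespace Summit.CriticalPhenomena.Ising3DConformalLimit.Theorems

open MeasureTheory Filter Topology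
open Literature.Probability.LatticeModels
open scoped BigOperators

namespace CriticalTwoPointGSMJs.DiagApproximants

/-- The swap symmetry of the diagonal data: `G(ι w - n u) = G(ι w + n u)`, since the coordinate
permutation `0 ↔ 1` fixes the plane site `ι w` and reverses the normal step `u = e₀ - e₁`
(Friedli–Velenik 2017, Exercise 3.14, `twoPointPlus_perm_invariant_holds`). -/
theorem swap_invariant (n : ℤ) (w : Fin 2 → ℤ) :
    criticalTwoPoint 3 (w 0 • (Pi.single 0 1 + Pi.single 1 1) + w 1 • Pi.single 2 1 +
        (-n) • (Pi.single 0 1 - Pi.single 1 1)) =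
      criticalTwoPoint 3 (w 0 • (Pi.single 0 1 + Pi.single 1 1) + w 1 • Pi.single 2 1 +
        n • (Pi.single 0 1 - Pi.single 1 1)) := by
  have h : ∀ x : Site 3, criticalTwoPoint 3 (fun i => x (Equiv.swap 0 1 i)) = criticalTwoPoint 3 x :=
    fun x => twoPointPlus_perm_invariant_holds (criticalBeta_nonneg 3) _ x
  rw [← h (w 0 • (Pi.single 0 1 + Pi.single 1 1) + w 1 • Pi.single 2 1 +
    n • (Pi.single 0 1 - Pi.single 1 1))]
  congr 1
  funext i
  fin_cases i <;> simp [Equiv.swap_apply_def]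

/-- `G(ι w + n u) = G(ι w + |n| u)` for `n ∈ ℤ` (the swap symmetry for `n < 0`). -/
theorem natAbs_invariant (n : ℤ) (w : Fin 2 → ℤ) :
    criticalTwoPoint 3 (w 0 • (Pi.single 0 1 + Pi.single 1 1) + w 1 • Pi.single 2 1 +
        n • (Pi.single 0 1 - Pi.single 1 1)) =
      criticalTwoPoint 3 (w 0 • (Pi.single 0 1 + Pi.single 1 1) + w 1 • Pi.single 2 1 +
        (n.natAbs : ℤ) • (Pi.single 0 1 - Pi.single 1 1)) := by
  obtain ⟨m, rfl | rfl⟩ := Int.eq_nat_or_neg n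
  · rw [Int.natAbs_natCast]
  · rw [Int.natAbs_neg, Int.natAbs_natCast, swap_invariant]

/-- The plane sites `ι w = w 0 • (e₀ + e₁) + w 1 • e₂` lie in the swap-mirror plane
`{x | x 0 = x 1}`. -/
theorem iota_apply_zero (w : Fin 2 → ℤ) :
    (w 0 • (Pi.single 0 1 + Pi.single 1 1) + w 1 • Pi.single 2 1 : Site 3) 0 =
      (w 0 • (Pi.single 0 1 + Pi.single 1 1) + w 1 • Pi.single 2 1 : Site 3) 1 := by
  simp

/-- The plane embedding `ι : ℤ² → ℤ³` is injective. -/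
theorem iota_injective :
    Function.Injective (fun w : Fin 2 → ℤ =>
      (w 0 • (Pi.single 0 1 + Pi.single 1 1) + w 1 • Pi.single 2 1 : Site 3)) := by
  intro x y h
  have h0 := congrFun h 0
  have h2 := congrFun h 2
  simp at h0 h2
  funext i
  fin_cases i
  · exact h0
  · exact h2

/-- The plane embedding is additive: `ι y - ι x + v = ι (y - x) + v`. -/
theorem iota_sub (x y : Fin 2 → ℤ) (v : Site 3) :
    (y 0 • (Pi.single 0 1 + Pi.single 1 1) + y 1 • Pi.single 2 1 : Site 3) -
        (x 0 • (Pi.single 0 1 + Pi.single 1 1) + x 1 • Pi.single 2 1) + v =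
      (y - x) 0 • (Pi.single 0 1 + Pi.single 1 1) + (y - x) 1 • Pi.single 2 1 + v := by
  simp only [Pi.sub_apply, sub_smul]
  abel

/-- The Hausdorff representation of the diagonal quadratic forms of `G`, transported from the
plane sites `ι(s)` (hypothesis `hD`, the statement of `Theorems.diagSpectralRepresentation`) to
`s ⊆ ℤ²`, with exponent `|n|`, `n ∈ ℤ` (swap symmetry `natAbs_invariant`):
`∑_{x,y ∈ s} c_x c_y G_d(n, x - y) = ∫ t^{|n|} dμ_c`. -/
theorem exists_hausdorff
    (hD : ∀ (s : Finset (Site 3)), (∀ x ∈ s, x 0 = x 1) → ∀ (v : Site 3 → ℝ),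
      ∃ μ : Measure ℝ, IsFiniteMeasure μ ∧ μ (Set.Icc (0 : ℝ) 1)ᶜ = 0 ∧
        ∀ N : ℕ, ∑ x ∈ s, ∑ y ∈ s, v x * v y *
          criticalTwoPoint 3 (y - x + (N : ℤ) • (Pi.single 0 1 - Pi.single 1 1)) = ∫ t, t ^ N ∂μ)
    (s : Finset (Fin 2 → ℤ)) (c : (Fin 2 → ℤ) → ℝ) :
    ∃ μ : Measure ℝ, IsFiniteMeasure μ ∧ μ (Set.Icc (0 : ℝ) 1)ᶜ = 0 ∧
      ∀ n : ℤ, ∑ x ∈ s, ∑ y ∈ s, c x * c y *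
        criticalTwoPoint 3 ((x - y) 0 • (Pi.single 0 1 + Pi.single 1 1) +
          (x - y) 1 • Pi.single 2 1 + n • (Pi.single 0 1 - Pi.single 1 1)) =
        ∫ t, t ^ n.natAbs ∂μ := by
  obtain ⟨μ, hfin, hsupp, hmom⟩ := hD (s.map ⟨_, iota_injective⟩)
    (fun x hx => by
      obtain ⟨w, _, rfl⟩ := Finset.mem_map.1 hx
      exact iota_apply_zero w)
    (Function.extend (fun w : Fin 2 → ℤ =>
      (w 0 • (Pi.single 0 1 + Pi.single 1 1) + w 1 • Pi.single 2 1 : Site 3)) c 0)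
  -- the representation on `ι(s)`, pulled back to `s` (exponent `m ∈ ℕ`)
  have hmom' : ∀ m : ℕ, ∑ x ∈ s, ∑ y ∈ s, c x * c y *
      criticalTwoPoint 3 ((y - x) 0 • (Pi.single 0 1 + Pi.single 1 1) +
        (y - x) 1 • Pi.single 2 1 + (m : ℤ) • (Pi.single 0 1 - Pi.single 1 1)) = ∫ t, t ^ m ∂μ := by
    intro m
    rw [← hmom m, Finset.sum_map]
    refine Finset.sum_congr rfl fun x _ => ?_
    rw [Finset.sum_map]
    refine Finset.sum_congr rfl fun y _ => ?_
    simp only [Function.Embedding.coeFn_mk, iota_injective.extend_apply]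
    rw [iota_sub]
  refine ⟨μ, hfin, hsupp, fun n => ?_⟩
  rw [← hmom' n.natAbs]
  refine Finset.sum_comm.trans (Finset.sum_congr rfl fun y _ => Finset.sum_congr rfl fun x _ => ?_)
  rw [mul_comm (c x) (c y), natAbs_invariant n]

end CriticalTwoPointGSMJs.DiagApproximants

open CriticalTwoPointGSMJs.JsApproximants CriticalTwoPointGSMJs.DiagApproximants in
/-- **STUB `diag_approximants` (the finite-`N` diagonal joint spectral measures).** Given the
collapsed identity of `diag_cesaroIdentity` (`hces`) and the diagonal Hausdorff representation of
`Theorems.diagSpectralRepresentation` (`hD`): for every `N ≥ 1` there is a probability measure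
`ρ_N` on `ℝ³` carried by `[0,1]×[-π,π]²` whose joint moments `∫ λ^{|n|} cos(k·z) dρ_N` equal the
Cesàro-weighted diagonal two-point function `#{(x,y) ∈ [0,N)⁴ : x-y = z}·G_d(n,z)/N²` for all
`n ∈ ℤ` and all `|zᵢ| < N`, where `G_d(n,z) = G(z 0 • (e₀+e₁) + z 1 • e₂ + n • (e₀-e₁))`
(`ρ_N = (N²(2N)²)⁻¹ ∑_j (μ_{cos,j} + μ_{sin,j}) ⊗ δ_{k_j}` with the diagonal Hausdorff measures of
`CriticalTwoPointGSMJs.DiagApproximants.exists_hausdorff`). -/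
theorem diag_approximants
    (hces : ∀ N : ℕ, 1 ≤ N → ∀ (n : ℤ) (z : Fin 2 → ℤ), (∀ i : Fin 2, |z i| < N) →
      ∑ j ∈ Fintype.piFinset (fun _ : Fin 2 => Finset.Ioc (-(N : ℤ)) N),
        Real.cos (∑ i : Fin 2, Real.pi * (j i : ℝ) * (z i : ℝ) / N) *
          ∑ x ∈ Fintype.piFinset (fun _ : Fin 2 => Finset.Ico (0 : ℤ) N),
            ∑ y ∈ Fintype.piFinset (fun _ : Fin 2 => Finset.Ico (0 : ℤ) N),
              (Real.cos (∑ i : Fin 2, Real.pi * (j i : ℝ) * (x i : ℝ) / N) *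
                  Real.cos (∑ i : Fin 2, Real.pi * (j i : ℝ) * (y i : ℝ) / N) +
                Real.sin (∑ i : Fin 2, Real.pi * (j i : ℝ) * (x i : ℝ) / N) *
                  Real.sin (∑ i : Fin 2, Real.pi * (j i : ℝ) * (y i : ℝ) / N)) *
              criticalTwoPoint 3 ((x - y) 0 • (Pi.single 0 1 + Pi.single 1 1) + (x - y) 1 • Pi.single 2 1 +
                n • (Pi.single 0 1 - Pi.single 1 1)) =
      (2 * (N : ℝ)) ^ 2 *
        ((((Fintype.piFinset (fun _ : Fin 2 => Finset.Ico (0 : ℤ) N)) ×ˢ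
            (Fintype.piFinset (fun _ : Fin 2 => Finset.Ico (0 : ℤ) N))).filter
            (fun xy => xy.1 - xy.2 = z)).card : ℝ) *
        criticalTwoPoint 3 (z 0 • (Pi.single 0 1 + Pi.single 1 1) + z 1 • Pi.single 2 1 +
          n • (Pi.single 0 1 - Pi.single 1 1)))
    (hD : ∀ (s : Finset (Site 3)), (∀ x ∈ s, x 0 = x 1) → ∀ (v : Site 3 → ℝ),
      ∃ μ : Measure ℝ, IsFiniteMeasure μ ∧ μ (Set.Icc (0 : ℝ) 1)ᶜ = 0 ∧
        ∀ N : ℕ, ∑ x ∈ s, ∑ y ∈ s, v x * v y *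
          criticalTwoPoint 3 (y - x + (N : ℤ) • (Pi.single 0 1 - Pi.single 1 1)) = ∫ t, t ^ N ∂μ) :
    ∀ N : ℕ, 1 ≤ N → ∃ ρ : Measure (Fin 3 → ℝ), IsProbabilityMeasure ρ ∧
      ρ {p | 0 ≤ p 0 ∧ p 0 ≤ 1 ∧ ∀ j : Fin 2, -Real.pi ≤ p j.succ ∧ p j.succ ≤ Real.pi}ᶜ = 0 ∧
      ∀ (n : ℤ) (z : Fin 2 → ℤ), (∀ i : Fin 2, |z i| < N) →
        ∫ p, (p 0) ^ n.natAbs * Real.cos (∑ j : Fin 2, p j.succ * (z j : ℝ)) ∂ρ =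
          ((((Fintype.piFinset (fun _ : Fin 2 => Finset.Ico (0 : ℤ) N)) ×ˢ
              (Fintype.piFinset (fun _ : Fin 2 => Finset.Ico (0 : ℤ) N))).filter
              (fun xy => xy.1 - xy.2 = z)).card : ℝ) / (N : ℝ) ^ 2 *
            criticalTwoPoint 3 (z 0 • (Pi.single 0 1 + Pi.single 1 1) + z 1 • Pi.single 2 1 +
              n • (Pi.single 0 1 - Pi.single 1 1)) := by
  intro N hN
  have hN0 : (N : ℝ) ≠ 0 := by exact_mod_cast Nat.one_le_iff_ne_zero.1 hN
  -- the diagonal Hausdorff measures of all real coefficient vectors on the box `[0,N)²`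
  choose μ hfin hsupp hspec using
    exists_hausdorff hD (Fintype.piFinset (fun _ : Fin 2 => Finset.Ico (0 : ℤ) N))
  -- the cosine / sine coefficient vectors at the momentum `k_j = πj/N` (local abbreviations)
  obtain ⟨vc, hvc⟩ : ∃ vc : (Fin 2 → ℤ) → (Fin 2 → ℤ) → ℝ,
      vc = fun j x => Real.cos (∑ i : Fin 2, Real.pi * (j i : ℝ) * (x i : ℝ) / N) := ⟨_, rfl⟩
  obtain ⟨vs, hvs⟩ : ∃ vs : (Fin 2 → ℤ) → (Fin 2 → ℤ) → ℝ,
      vs = fun j x => Real.sin (∑ i : Fin 2, Real.pi * (j i : ℝ) * (x i : ℝ) / N) := ⟨_, rfl⟩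
  -- the axis measure `μ_{c,j} + μ_{s,j}` at the momentum `j`: support and moments
  have hsupp2 : ∀ j : Fin 2 → ℤ, (μ (vc j) + μ (vs j)) (Set.Icc (0 : ℝ) 1)ᶜ = 0 := fun j => by
    rw [Measure.add_apply, hsupp, hsupp, add_zero]
  have hmom1 : ∀ (j : Fin 2 → ℤ) (n : ℤ), ∫ t, t ^ n.natAbs ∂(μ (vc j) + μ (vs j)) =
      ∑ x ∈ Fintype.piFinset (fun _ : Fin 2 => Finset.Ico (0 : ℤ) N),
        ∑ y ∈ Fintype.piFinset (fun _ : Fin 2 => Finset.Ico (0 : ℤ) N),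
          (vc j x * vc j y + vs j x * vs j y) *
            criticalTwoPoint 3 ((x - y) 0 • (Pi.single 0 1 + Pi.single 1 1) +
              (x - y) 1 • Pi.single 2 1 + n • (Pi.single 0 1 - Pi.single 1 1)) := by
    intro j n
    rw [integral_add_measure (integrable_pow (hsupp _) _) (integrable_pow (hsupp _) _),
      ← hspec, ← hspec]
    simp only [add_mul, Finset.sum_add_distrib]
  -- the joint moments of `ρ_N := (N²(2N)²)⁻¹ ∑_j (t ↦ (t, k_j))_* (μ_{c,j} + μ_{s,j})`
  have hmom : ∀ (n : ℤ) (z : Fin 2 → ℤ), (∀ i : Fin 2, |z i| < N) →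
      ∫ p, (p 0) ^ n.natAbs * Real.cos (∑ j : Fin 2, p j.succ * (z j : ℝ))
        ∂(((N : NNReal) ^ 2 * (2 * N) ^ 2)⁻¹ •
          ∑ j ∈ Fintype.piFinset (fun _ : Fin 2 => Finset.Ioc (-(N : ℤ)) N),
            (μ (vc j) + μ (vs j)).map
              (fun t : ℝ => (Fin.cons t (fun i : Fin 2 => Real.pi * (j i : ℝ) / N) : Fin 3 → ℝ))) =
          ((((Fintype.piFinset (fun _ : Fin 2 => Finset.Ico (0 : ℤ) N)) ×ˢ
              (Fintype.piFinset (fun _ : Fin 2 => Finset.Ico (0 : ℤ) N))).filter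
              (fun xy => xy.1 - xy.2 = z)).card : ℝ) / (N : ℝ) ^ 2 *
            criticalTwoPoint 3 (z 0 • (Pi.single 0 1 + Pi.single 1 1) + z 1 • Pi.single 2 1 +
              n • (Pi.single 0 1 - Pi.single 1 1)) := by
    intro n z hz
    rw [integral_smul_nnreal_measure,
      integral_finsetSum_measure (fun j _ => integrable_map_cons _ _ (hsupp2 j) n z)]
    have h2 : ∑ j ∈ Fintype.piFinset (fun _ : Fin 2 => Finset.Ioc (-(N : ℤ)) N),
        ∫ p, (p 0) ^ n.natAbs * Real.cos (∑ j : Fin 2, p j.succ * (z j : ℝ))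
          ∂((μ (vc j) + μ (vs j)).map
            (fun t : ℝ => (Fin.cons t (fun i : Fin 2 => Real.pi * (j i : ℝ) / N) : Fin 3 → ℝ))) =
        (2 * (N : ℝ)) ^ 2 *
          ((((Fintype.piFinset (fun _ : Fin 2 => Finset.Ico (0 : ℤ) N)) ×ˢ
              (Fintype.piFinset (fun _ : Fin 2 => Finset.Ico (0 : ℤ) N))).filter
              (fun xy => xy.1 - xy.2 = z)).card : ℝ) *
          criticalTwoPoint 3 (z 0 • (Pi.single 0 1 + Pi.single 1 1) + z 1 • Pi.single 2 1 +
            n • (Pi.single 0 1 - Pi.single 1 1)) := by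
      rw [← hces N hN n z hz]
      refine Finset.sum_congr rfl (fun j _ => ?_)
      rw [integral_map_cons, hmom1, mul_comm]
      subst hvc hvs
      simp only [div_mul_eq_mul_div]
    rw [h2, NNReal.smul_def, smul_eq_mul]
    simp only [NNReal.coe_inv, NNReal.coe_mul, NNReal.coe_pow, NNReal.coe_natCast,
      NNReal.coe_ofNat]
    exact weight_identity hN0 _ _
  refine ⟨_, ⟨?_⟩, ?_, hmom⟩
  · -- total mass one: the moment identity at `n = 0`, `z = 0`
    rw [← ENNReal.toReal_eq_one_iff]
    have h1 := hmom 0 0 (fun i => by simp only [Pi.zero_apply, abs_zero]; exact_mod_cast hN)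
    simp only [Int.natAbs_zero, pow_zero, Pi.zero_apply, Int.cast_zero, mul_zero,
      Finset.sum_const_zero, Real.cos_zero, mul_one, integral_const, smul_eq_mul,
      measureReal_def, zero_smul, add_zero, criticalTwoPoint_zero'] at h1
    rw [h1, card_filter_sub_eq_zero, Nat.cast_pow, div_self (pow_ne_zero 2 hN0)]
  · -- carried by the box `[0,1]×[-π,π]²`
    rw [Measure.smul_apply, Measure.finsetSum_apply, Finset.sum_eq_zero
      (fun j hj => map_cons_compl_box (fun i => momentum_mem hN hj i) _ (hsupp2 j)), smul_zero]

end Summit.CriticalPhenomena.Ising3DConformalLimit.Theorems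

end
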